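import Summits.MatrixMultiplication.MatrixMultiplication.Theorems.SoloBlindSignedSumDistinct

/-!
# The Kraft inequality (K₃) at corank two, in every rank (exponent three)

Sub-programme (K₃): `K(τ; S) = ∑_{T ⊆ S, ∑_T h = τ} 2^{-|T|} ≤ 1` (`soloBlindMass`) for zero-sum-free `h` over
`𝔽₃`.  `SoloBlindCorankOneKraft` proved it for `S = B ∪ {p}` with `B` sum-distinct (over any abelian group).  Here:
corank TWO, where the exponent-`3` hypothesis becomes essential (over `ℤ` the sequence `(1, 1, 1)` has `K(1) = 3/2`).

* `soloBlind_kraft_corank_two` — (K₃) AT CORANK TWO: `G` of exponent `3`, `B` sum-distinct for `h`, `p ≠ q` outside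
  `B` (values `h p`, `h q` unrestricted, so sequences are covered), `h` zero-sum free on `S = B ∪ {p, q}`; then
  `K(τ; S) ≤ 1` for every `τ`.  Proof: two deletions give
  `K(τ; S) = K_B(τ) + K_B(τ-a)/2 + K_B(τ-b)/2 + K_B(τ-a-b)/4` (`a = h p`, `b = h q`), each `K_B` being `0` or `2^{-n}`
  (unique representations `A₀, A₁, A₂, A₃`).  Zero-sum-freeness kills `A₃` when `A₁ = ∅` or `A₂ = ∅`, kills
  everything else when `A₀ = ∅`, and kills the value configurations `h s = τ = a` with `A₂` present
  (`soloBlind_kill_P2`) and `a = b = τ` with `A₀` present; signed sum-distinctness kills the two remaining heavy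
  patterns `|A₀| = |A₁| = |A₂| = 1, A₃ present` (`soloBlind_kill_P4`) and `|A₀| = |A₁| = 1, A₃ = ∅, A₂ present`
  (`soloBlind_kill_P5`); every surviving pattern has total weight `≤ 1` by arithmetic.
* `soloBlind_kraft_basis_add_two` — the linear-independence form: (K₃) for zero-sum-free sequences of length
  `≤ rank + 2` in groups of exponent `3`, in every rank.

(K3.29: the type search proves corank `≤ 3`; this is the hand certificate for corank `2`.)
-/

namespace Summit.MatrixMultiplication.MatrixMultiplication.Theorems

open Finset

universe u

variable {ι : Type*} [DecidableEq ι]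
variable {G : Type u} [AddCommGroup G] [DecidableEq G]

/-! ## (K₃) at corank two -/

/-- (K₃) AT CORANK TWO (every rank, every target; exponent `3`): for a sum-distinct `B`, `p ≠ q` outside `B` and
`h` zero-sum free on `B ∪ {p, q}`, `K(τ; B ∪ {p, q}) ≤ 1`. -/
theorem soloBlind_kraft_corank_two (three : ∀ g : G, g + g + g = 0) {h : ι → G} {B : Finset ι} {p q : ι}
    (hpB : p ∉ B) (hqB : q ∉ B) (hpq : p ≠ q)
    (hdist : ∀ A ⊆ B, ∀ A' ⊆ B, ∑ i ∈ A, h i = ∑ i ∈ A', h i → A = A')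
    (zsf : ∀ T ⊆ insert q (insert p B), T.Nonempty → ∑ i ∈ T, h i ≠ 0) (τ : G) :
    soloBlindMass h (insert q (insert p B)) τ ≤ 1 := by
  -- membership bookkeeping
  have hqS : q ∈ insert q (insert p B) := Finset.mem_insert_self q _
  have hpS : p ∈ insert q (insert p B) := Finset.mem_insert_of_mem (Finset.mem_insert_self p B)
  have hBS : B ⊆ insert q (insert p B) := (Finset.subset_insert p B).trans (Finset.subset_insert q _)
  have hq' : q ∉ insert p B := by
    intro hq
    rcases Finset.mem_insert.mp hq with hq | hq
    · exact hpq hq.symm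
    · exact hqB hq
  have ha : h p ≠ 0 := fun e => zsf {p} (Finset.singleton_subset_iff.mpr hpS)
    (Finset.singleton_nonempty p) (by rw [Finset.sum_singleton, e])
  have hb : h q ≠ 0 := fun e => zsf {q} (Finset.singleton_subset_iff.mpr hqS)
    (Finset.singleton_nonempty q) (by rw [Finset.sum_singleton, e])
  -- two deletions
  rw [soloBlind_mass_erase h hqS τ, Finset.erase_insert hq', soloBlind_mass_erase h (Finset.mem_insert_self p B) τ,
    soloBlind_mass_erase h (Finset.mem_insert_self p B) (τ - h q), Finset.erase_insert hpB]
  -- generic bounds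
  have m0 := soloBlind_mass_le_one_of_sumDistinct hdist τ
  have m1 := soloBlind_mass_le_one_of_sumDistinct hdist (τ - h p)
  have m2 := soloBlind_mass_le_one_of_sumDistinct hdist (τ - h q)
  have m3 := soloBlind_mass_le_one_of_sumDistinct hdist (τ - h q - h p)
  have z0 := soloBlind_mass_nonneg h B τ
  have z1 := soloBlind_mass_nonneg h B (τ - h p)
  have z2 := soloBlind_mass_nonneg h B (τ - h q)
  have z3 := soloBlind_mass_nonneg h B (τ - h q - h p)
  -- representation facts
  have rep : ∀ {x : G} {A : Finset ι}, A ∈ soloBlindSeqRepAll h B x → A ⊆ B ∧ ∑ i ∈ A, h i = x :=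
    fun hA => soloBlind_mem_seqRepAll.mp hA
  -- F0: a representation `A₃` of `τ - b - a` forces `A₁ ≠ ∅` and `A₂ ≠ ∅`
  have F1 : ∀ A₃ ∈ soloBlindSeqRepAll h B (τ - h q - h p), ∀ T ∈ soloBlindSeqRepAll h B (τ - h p),
      1 ≤ T.card := by
    intro A₃ hA₃ T hT
    rw [Nat.one_le_iff_ne_zero, Ne, Finset.card_eq_zero]
    intro hT0
    obtain ⟨-, hTs⟩ := rep hT
    rw [hT0, Finset.sum_empty] at hTs
    obtain ⟨hA₃B, hA₃s⟩ := rep hA₃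
    have hτa : τ = h p := sub_eq_zero.mp hTs.symm
    refine soloBlind_kill_one zsf hBS hqS hqB hA₃B ?_
    rw [hA₃s, hτa]
    abel
  have F2 : ∀ A₃ ∈ soloBlindSeqRepAll h B (τ - h q - h p), ∀ T ∈ soloBlindSeqRepAll h B (τ - h q),
      1 ≤ T.card := by
    intro A₃ hA₃ T hT
    rw [Nat.one_le_iff_ne_zero, Ne, Finset.card_eq_zero]
    intro hT0
    obtain ⟨-, hTs⟩ := rep hT
    rw [hT0, Finset.sum_empty] at hTs
    obtain ⟨hA₃B, hA₃s⟩ := rep hA₃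
    have hτb : τ = h q := sub_eq_zero.mp hTs.symm
    refine soloBlind_kill_one zsf hBS hpS hpB hA₃B ?_
    rw [hA₃s, hτb]
    abel
  -- the case analysis
  rcases (soloBlindSeqRepAll h B τ).eq_empty_or_nonempty with hR0 | ⟨A₀, hA₀⟩
  · -- (1) no representation of `τ` inside `B`
    rw [soloBlind_mass_eq_zero_of_repAll_eq_empty hR0]
    rcases (soloBlindSeqRepAll h B (τ - h q - h p)).eq_empty_or_nonempty with hR3 | ⟨A₃, hA₃⟩
    · rw [soloBlind_mass_eq_zero_of_repAll_eq_empty hR3]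
      linarith
    · have m1' := soloBlind_mass_le_pow_of_card_le_one h B (τ - h p) 1
        (soloBlind_repAll_card_le_one_of_sumDistinct hdist _) (F1 A₃ hA₃)
      have m2' := soloBlind_mass_le_pow_of_card_le_one h B (τ - h q) 1
        (soloBlind_repAll_card_le_one_of_sumDistinct hdist _) (F2 A₃ hA₃)
      rw [pow_one] at m1' m2'
      linarith
  · obtain ⟨hA₀B, hA₀s⟩ := rep hA₀
    rcases Nat.eq_zero_or_pos A₀.card with n00 | n0pos
    · -- (2·0) `τ = 0`: every other representation is a zero-sum with `p`, `q` or both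
      rw [Finset.card_eq_zero] at n00
      rw [n00, Finset.sum_empty] at hA₀s
      have hR1 : soloBlindSeqRepAll h B (τ - h p) = ∅ := by
        rw [Finset.eq_empty_iff_forall_notMem]
        intro T hT
        obtain ⟨hTB, hTs⟩ := rep hT
        refine soloBlind_kill_one zsf hBS hpS hpB hTB ?_
        rw [hTs, ← hA₀s]
        abel
      have hR2 : soloBlindSeqRepAll h B (τ - h q) = ∅ := by
        rw [Finset.eq_empty_iff_forall_notMem]
        intro T hT
        obtain ⟨hTB, hTs⟩ := rep hT
        refine soloBlind_kill_one zsf hBS hqS hqB hTB ?_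
        rw [hTs, ← hA₀s]
        abel
      have hR3 : soloBlindSeqRepAll h B (τ - h q - h p) = ∅ := by
        rw [Finset.eq_empty_iff_forall_notMem]
        intro T hT
        obtain ⟨hTB, hTs⟩ := rep hT
        refine soloBlind_kill_two zsf hBS hpS hqS hpB hqB hpq hTB ?_
        rw [hTs, ← hA₀s]
        abel
      rw [soloBlind_mass_eq_zero_of_repAll_eq_empty hR1, soloBlind_mass_eq_zero_of_repAll_eq_empty hR2,
        soloBlind_mass_eq_zero_of_repAll_eq_empty hR3]
      linarith
    · -- (2·1) `|A₀| ≥ 1`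
      have m0' := soloBlind_mass_le_pow_of_rep hdist hA₀ (n := 1) n0pos
      rw [pow_one] at m0'
      rcases (soloBlindSeqRepAll h B (τ - h p)).eq_empty_or_nonempty with hR1 | ⟨A₁, hA₁⟩
      · -- (i) no representation of `τ - a`
        rw [soloBlind_mass_eq_zero_of_repAll_eq_empty hR1]
        rcases (soloBlindSeqRepAll h B (τ - h q - h p)).eq_empty_or_nonempty with hR3 | ⟨A₃, hA₃⟩
        · rw [soloBlind_mass_eq_zero_of_repAll_eq_empty hR3]
          linarith
        · have m2' := soloBlind_mass_le_pow_of_card_le_one h B (τ - h q) 1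
            (soloBlind_repAll_card_le_one_of_sumDistinct hdist _) (F2 A₃ hA₃)
          rw [pow_one] at m2'
          linarith
      · obtain ⟨hA₁B, hA₁s⟩ := rep hA₁
        rcases Nat.eq_zero_or_pos A₁.card with n10 | n1pos
        · -- (ii, n₁ = 0) `τ = a`: `A₃` is absent
          rw [Finset.card_eq_zero] at n10
          rw [n10, Finset.sum_empty] at hA₁s
          have hτa : τ = h p := (sub_eq_zero.mp hA₁s.symm)
          have hR3 : soloBlindSeqRepAll h B (τ - h q - h p) = ∅ := by
            rw [Finset.eq_empty_iff_forall_notMem]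
            intro T hT
            obtain ⟨hTB, hTs⟩ := rep hT
            refine soloBlind_kill_one zsf hBS hqS hqB hTB ?_
            rw [hTs, hτa]
            abel
          rw [soloBlind_mass_eq_zero_of_repAll_eq_empty hR3]
          rcases (soloBlindSeqRepAll h B (τ - h q)).eq_empty_or_nonempty with hR2 | ⟨A₂, hA₂⟩
          · rw [soloBlind_mass_eq_zero_of_repAll_eq_empty hR2]
            linarith
          · obtain ⟨hA₂B, hA₂s⟩ := rep hA₂
            rcases Nat.lt_or_ge A₀.card 2 with n0lt | n0ge
            · -- `|A₀| = 1`: pattern P2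
              exfalso
              have n01 : A₀.card = 1 := by omega
              obtain ⟨s, hs⟩ := Finset.card_eq_one.mp n01
              rw [hs, Finset.sum_singleton] at hA₀s
              have hsB : s ∈ B := hA₀B (by rw [hs]; exact Finset.mem_singleton_self s)
              refine soloBlind_kill_P2 three zsf hBS hpS hqS hpB hqB hpq hsB (by rw [hA₀s, hτa]) hA₂B ?_
              rw [hA₂s, hA₀s]
            · -- `|A₀| ≥ 2`: then `A₂ ≠ ∅` (else `a = b = τ`, pattern P3) and the weights add up
              have m0'' := soloBlind_mass_le_pow_of_rep hdist hA₀ (n := 2) n0ge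
              have n2pos : 1 ≤ A₂.card := by
                rw [Nat.one_le_iff_ne_zero, Ne, Finset.card_eq_zero]
                intro h20
                rw [h20, Finset.sum_empty] at hA₂s
                have hτb : τ = h q := (sub_eq_zero.mp hA₂s.symm)
                refine soloBlind_kill_two zsf hBS hpS hqS hpB hqB hpq hA₀B ?_
                rw [hA₀s]
                have key : τ + h p + h q = τ + τ + τ := by rw [← hτa, ← hτb]
                rw [key]
                exact three τ
              have m2' := soloBlind_mass_le_pow_of_rep hdist hA₂ n2pos
              rw [pow_one] at m2'
              norm_num at m0''
              linarith
        · -- (n₁ ≥ 1)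
          have m1' := soloBlind_mass_le_pow_of_rep hdist hA₁ n1pos
          rw [pow_one] at m1'
          rcases (soloBlindSeqRepAll h B (τ - h q)).eq_empty_or_nonempty with hR2 | ⟨A₂, hA₂⟩
          · -- (iii) no representation of `τ - b`
            rw [soloBlind_mass_eq_zero_of_repAll_eq_empty hR2]
            linarith
          · obtain ⟨hA₂B, hA₂s⟩ := rep hA₂
            rcases Nat.eq_zero_or_pos A₂.card with n20 | n2pos
            · -- (iv, n₂ = 0) `τ = b`: `A₃` absent; `|A₀| = 1` is pattern P2 with `p, q` exchanged
              rw [Finset.card_eq_zero] at n20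
              rw [n20, Finset.sum_empty] at hA₂s
              have hτb : τ = h q := (sub_eq_zero.mp hA₂s.symm)
              have hR3 : soloBlindSeqRepAll h B (τ - h q - h p) = ∅ := by
                rw [Finset.eq_empty_iff_forall_notMem]
                intro T hT
                obtain ⟨hTB, hTs⟩ := rep hT
                refine soloBlind_kill_one zsf hBS hpS hpB hTB ?_
                rw [hTs, hτb]
                abel
              rw [soloBlind_mass_eq_zero_of_repAll_eq_empty hR3]
              rcases Nat.lt_or_ge A₀.card 2 with n0lt | n0ge
              · exfalso
                have n01 : A₀.card = 1 := by omega
                obtain ⟨s, hs⟩ := Finset.card_eq_one.mp n01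
                rw [hs, Finset.sum_singleton] at hA₀s
                have hsB : s ∈ B := hA₀B (by rw [hs]; exact Finset.mem_singleton_self s)
                exact soloBlind_kill_P2 three zsf hBS hqS hpS hqB hpB (Ne.symm hpq) hsB (by rw [hA₀s, hτb]) hA₁B
                  (by rw [hA₁s, hA₀s])
              · have m0'' := soloBlind_mass_le_pow_of_rep hdist hA₀ (n := 2) n0ge
                norm_num at m0''
                linarith
            · -- (n₂ ≥ 1)
              have m2' := soloBlind_mass_le_pow_of_rep hdist hA₂ n2pos
              rw [pow_one] at m2'
              rcases Nat.lt_or_ge A₀.card 2 with n0lt | n0ge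
              · -- `|A₀| = 1`: `h s = τ`
                have n01 : A₀.card = 1 := by omega
                obtain ⟨s, hs⟩ := Finset.card_eq_one.mp n01
                rw [hs, Finset.sum_singleton] at hA₀s
                have hsB : s ∈ B := hA₀B (by rw [hs]; exact Finset.mem_singleton_self s)
                rcases (soloBlindSeqRepAll h B (τ - h q - h p)).eq_empty_or_nonempty with hR3 | ⟨A₃, hA₃⟩
                · rw [soloBlind_mass_eq_zero_of_repAll_eq_empty hR3]
                  linarith
                · obtain ⟨hA₃B, hA₃s⟩ := rep hA₃
                  rcases Nat.lt_or_ge A₁.card 2 with n1lt | n1ge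
                  · -- `|A₁| = 1`
                    have n11 : A₁.card = 1 := by omega
                    obtain ⟨s₁, hs₁⟩ := Finset.card_eq_one.mp n11
                    rw [hs₁, Finset.sum_singleton] at hA₁s
                    have hs₁B : s₁ ∈ B := hA₁B (by rw [hs₁]; exact Finset.mem_singleton_self s₁)
                    rcases Nat.lt_or_ge A₂.card 2 with n2lt | n2ge
                    · -- `|A₂| = 1`: pattern P4
                      exfalso
                      have n21 : A₂.card = 1 := by omega
                      obtain ⟨s₂, hs₂⟩ := Finset.card_eq_one.mp n21
                      rw [hs₂, Finset.sum_singleton] at hA₂s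
                      have hs₂B : s₂ ∈ B := hA₂B (by rw [hs₂]; exact Finset.mem_singleton_self s₂)
                      exact soloBlind_kill_P4 three hdist ha hb hsB hs₁B hs₂B hA₀s hA₁s hA₂s hA₃B hA₃s
                    · -- `|A₂| ≥ 2`: then `A₃ ≠ ∅` (pattern P5) and the weights add up
                      have m2'' := soloBlind_mass_le_pow_of_rep hdist hA₂ n2ge
                      have n3pos : 1 ≤ A₃.card := by
                        rw [Nat.one_le_iff_ne_zero, Ne, Finset.card_eq_zero]
                        intro h30
                        rw [h30, Finset.sum_empty] at hA₃s
                        have hτ : τ = h p + h q := by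
                          have e := hA₃s.symm
                          rw [sub_sub, sub_eq_zero] at e
                          rw [e, add_comm]
                        exact soloBlind_kill_P5 three hdist ha hsB hs₁B hA₀s hA₁s hτ hA₂B hA₂s
                      have m3' := soloBlind_mass_le_pow_of_rep hdist hA₃ n3pos
                      rw [pow_one] at m3'
                      norm_num at m2''
                      linarith
                  · -- `|A₁| ≥ 2`
                    have m1'' := soloBlind_mass_le_pow_of_rep hdist hA₁ n1ge
                    norm_num at m1''
                    rcases Nat.lt_or_ge A₂.card 2 with n2lt | n2ge
                    · -- `|A₂| = 1`: `A₃ ≠ ∅` by pattern P5 with `p, q` exchanged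
                      have n21 : A₂.card = 1 := by omega
                      obtain ⟨s₂, hs₂⟩ := Finset.card_eq_one.mp n21
                      rw [hs₂, Finset.sum_singleton] at hA₂s
                      have hs₂B : s₂ ∈ B := hA₂B (by rw [hs₂]; exact Finset.mem_singleton_self s₂)
                      have n3pos : 1 ≤ A₃.card := by
                        rw [Nat.one_le_iff_ne_zero, Ne, Finset.card_eq_zero]
                        intro h30
                        rw [h30, Finset.sum_empty] at hA₃s
                        have hτ : τ = h q + h p := by
                          have e := hA₃s.symm
                          rw [sub_sub, sub_eq_zero] at e
                          rw [e]
                        refine soloBlind_kill_P5 three hdist hb hsB hs₂B hA₀s hA₂s hτ hA₁B ?_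
                        rw [hA₁s]
                      have m3' := soloBlind_mass_le_pow_of_rep hdist hA₃ n3pos
                      rw [pow_one] at m3'
                      linarith
                    · have m2'' := soloBlind_mass_le_pow_of_rep hdist hA₂ n2ge
                      norm_num at m2''
                      linarith
              · -- `|A₀| ≥ 2`
                have m0'' := soloBlind_mass_le_pow_of_rep hdist hA₀ (n := 2) n0ge
                norm_num at m0''
                linarith

section LinearIndependence

variable {R : Type*} [Ring R] [Nontrivial R] [Module R G]

/-- (K₃) FOR SEQUENCES OF LENGTH `≤ rank + 2`, EVERY RANK (exponent `3`): if `h` is linearly independent on `B`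
(elementary form), `p ≠ q` lie outside `B` and `h` is zero-sum free on `B ∪ {p, q}`, then `K(τ; B ∪ {p, q}) ≤ 1`
for every `τ`. -/
theorem soloBlind_kraft_basis_add_two (three : ∀ g : G, g + g + g = 0) {h : ι → G} {B : Finset ι} {p q : ι}
    (hpB : p ∉ B) (hqB : q ∉ B) (hpq : p ≠ q)
    (hli : ∀ g : ι → R, ∑ i ∈ B, g i • h i = 0 → ∀ i ∈ B, g i = 0)
    (zsf : ∀ T ⊆ insert q (insert p B), T.Nonempty → ∑ i ∈ T, h i ≠ 0) (τ : G) :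
    soloBlindMass h (insert q (insert p B)) τ ≤ 1 :=
  soloBlind_kraft_corank_two three hpB hqB hpq (soloBlind_sumDistinct_of_linearIndependent (R := R) hli) zsf τ

end LinearIndependence

end Summit.MatrixMultiplication.MatrixMultiplication.Theorems
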